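import Summits.ResolutionOfSingularities.ResolutionOfSingularities.Theorems.FrobeniusLadderFRationalResolutionCharacteristicTowerCentre
import Summits.ResolutionOfSingularities.ResolutionOfSingularities.Theorems.FrobeniusLadderFRationalResolutionCharacteristicTower
import Summits.ResolutionOfSingularities.ResolutionOfSingularities.Theorems.FrobeniusLadderFRationalResolutionFixedStratumAffineCentre
import Literature.AlgebraicGeometry.CossartJannsenSaito2020.BlowupTowerLocalize
import Literature.AlgebraicGeometry.Resolution.BlowupRegularFlatCover
import Literature.AlgebraicGeometry.Resolution.BlowupsExistence
import HarnessLib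

/-!
# Crux `FrobeniusLadder.FRationalResolution` (stmt-ResolutionOfSingularities-15317), line `redirect`,
# stub `stub_diagonalizableQuotientResolution` — BLOWING UP A CLOSED DISCRETE SET OF SINGULAR POINTS IS REGULAR AS SOON AS IT IS SO
# IN THE LOCAL RINGS; THE CONIFOLD STEP OF THE INTRINSIC RECIPE, PACKAGED (MEMO-15317-leafhand2-g16 §2(c) second step)

Let `X` be a locally Noetherian scheme, `Z ⊆ X` a closed set of CLOSED points (e.g. the finitely many conifold points of the first
intrinsic blow-up), with `X ∖ Z` regular and, for every `z ∈ Z`, `Bl_{𝔪_z}(Spec 𝒪_{X,z})` regular (for an ordinary double point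
`xy = zw` one blow-up of the vertex resolves). Then EVERY blowing up of `X` in the reduced ideal `𝓘_Z` of `Z` is regular. The proof
is the tree's flat-cover criterion `IsBlowup.isRegular_of_flat_cover` for the family `{X ∖ Z ↪ X} ∪ {Spec 𝒪_{X,z} → X : z ∈ Z}`:
the reduced centre pulls back to `⊤` on `X ∖ Z` (blow-up = identity) and to `𝔪_z~` on `Spec 𝒪_{X,z}` (the only point of
`Spec 𝒪_{X,z}` over `Z` is the closed point, as the points of `Z` are closed), by `comap_vanishingIdeal_eq_of_flat_of_isPreimmersion`.

* `preimage_eq_bot_of_compl` / `preimage_fromSpecStalk_eq_zeroLocus_maximalIdeal` — the two pull-backs of `Z`;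
* ★ `isRegular_of_isBlowup_vanishingIdeal_points` — the statement above;
* ★★ `exists_characteristic_ideal_isRegular_of_pointStep` — THE CONIFOLD STEP PACKAGED: `R` Noetherian, `J₁ ⊇ 𝔪ⁿ` characteristic,
  `J₁ ≠ ⊤`, `X₁ = Bl_{J₁}(Spec R)`, `Z ⊆ X₁` a closed set of closed points over `V(𝔪)` with `X₁ ∖ Z` regular, `Z` stable under the
  automorphisms of `X₁` covering automorphisms of `Spec R` (e.g. `Z = Sing X₁`), and `Bl_{𝔪_z}(Spec 𝒪_{X₁,z})` regular for `z ∈ Z` ⇒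
  a CHARACTERISTIC ideal `J₂ ⊇ 𝔪ᶜ`, `J₂ ≠ ⊤`, with `Bl_{J₂}(Spec R)` REGULAR — exactly the input of
  `…GaloisCharacteristicCentre.hloc_of_characteristic_ideal_adicCompletion` (p838347); with `Z = Sing X₁`:
  `exists_characteristic_ideal_isRegular_of_singularPoints`.

Honest label: plumbing toward ONE leaf stub (no stub, crux or summit closed). No definitions, no named facts, no sorry.
[cite: GortzWedhorn2020, Prop. 13.91 (2); (13.19) p. 413] [cite: Matsumura1987, Thm. 23.7 (i)] [cite: StacksProject, Tag 080B; Tag 02NS]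
-/

noncomputable section

-- single-problem summit: the doubled namespace component is forced
set_option linter.dupNamespace false

open CategoryTheory CategoryTheory.Limits AlgebraicGeometry TopologicalSpace IsLocalRing
open Literature.AlgebraicGeometry.Resolution
open Literature.AlgebraicGeometry.CossartJannsenSaito2020
open Summit.ResolutionOfSingularities.ResolutionOfSingularities.Theorems.FRationalResolution

namespace Summit.ResolutionOfSingularities.ResolutionOfSingularities.Theorems.FRationalResolution.PointCentreBlowupRegular

/-! ## §1 The two pull-backs of the centre -/

/-- The preimage of `Z` in an open `U ⊆ X ∖ Z` is empty. [folklore] -/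
theorem preimage_eq_bot_of_subset_compl {X : Scheme.{0}} (Z : Set X) (hZc : IsClosed Z) (U : X.Opens)
    (hU : ∀ x : X, x ∈ U → x ∉ Z) :
    (⟨Z, hZc⟩ : Closeds X).preimage U.ι.continuous = ⊥ := by
  refine Closeds.ext (Set.eq_empty_of_forall_notMem fun u hu => ?_)
  change U.ι u ∈ Z at hu
  rw [Scheme.Opens.ι_apply] at hu
  exact hU _ u.2 hu

/-- The preimage of a closed set of CLOSED points under `Spec 𝒪_{X,z} → X`, `z ∈ Z`, is the closed point alone, i.e. `V(𝔪_z)`.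
[cite: StacksProject, Tag 01J7] -/
theorem preimage_fromSpecStalk_eq_zeroLocus_maximalIdeal {X : Scheme.{0}} (Z : Set X) (hZc : IsClosed Z)
    (hpt : ∀ z ∈ Z, IsClosed ({z} : Set X)) (z : X) (hz : z ∈ Z) :
    (⟨Z, hZc⟩ : Closeds X).preimage (X.fromSpecStalk z).continuous =
      ⟨PrimeSpectrum.zeroLocus ((maximalIdeal (X.presheaf.stalk z) : Ideal (X.presheaf.stalk z)) : Set (X.presheaf.stalk z)),
        PrimeSpectrum.isClosed_zeroLocus _⟩ := by
  refine Closeds.ext (Set.ext fun p => ?_)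
  change (X.fromSpecStalk z) p ∈ Z ↔ p ∈ PrimeSpectrum.zeroLocus _
  constructor
  · intro hp
    -- `ι p ⤳ z` and `ι p` is a closed point, so `ι p = z = ι (closed point)`
    have hsp : (X.fromSpecStalk z) p ⤳ z := by
      have h : (X.fromSpecStalk z) p ∈ Set.range (X.fromSpecStalk z) := ⟨p, rfl⟩
      rw [Scheme.range_fromSpecStalk] at h
      exact h
    have heq : (X.fromSpecStalk z) p = z := by
      have h := specializes_iff_mem_closure.mp hsp
      rw [(hpt _ hp).closure_eq, Set.mem_singleton_iff] at h
      exact h.symm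
    have hp' : p = closedPoint (X.presheaf.stalk z) :=
      (X.fromSpecStalk z).isEmbedding.injective (by rw [heq, Scheme.fromSpecStalk_closedPoint])
    subst hp'
    change (maximalIdeal (X.presheaf.stalk z) : Set (X.presheaf.stalk z)) ⊆ (closedPoint (X.presheaf.stalk z)).asIdeal
    exact le_rfl
  · intro hp
    have hle : maximalIdeal (X.presheaf.stalk z) ≤ p.asIdeal := hp
    have hp' : p = closedPoint (X.presheaf.stalk z) :=
      PrimeSpectrum.ext ((IsLocalRing.maximalIdeal.isMaximal _).eq_of_le p.2.ne_top hle).symm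
    rw [hp', Scheme.fromSpecStalk_closedPoint]
    exact hz

/-! ## §2 The two members of the cover -/

/-- Over an open `U ⊆ X ∖ Z` consisting of regular points the centre `𝓘_Z` pulls back to `⊤`, so every blowing up of `U` in it is
an isomorphism onto the regular `U`. [cite: GortzWedhorn2020, (13.19) p. 413] -/
theorem isRegular_of_isBlowup_comap_opens {X : Scheme.{0}} (Z : Set X) (hZc : IsClosed Z) (U : X.Opens)
    (hU : ∀ x : X, x ∈ U → x ∉ Z) (hreg : ∀ x : X, x ∈ U → x ∈ Scheme.regularLocus X)
    {P : Scheme.{0}} (q : P ⟶ U) (hq : IsBlowup q ((Scheme.IdealSheafData.vanishingIdeal ⟨Z, hZc⟩).comap U.ι)) :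
    Scheme.IsRegular P := by
  rw [comap_vanishingIdeal_eq_of_flat_of_isPreimmersion, preimage_eq_bot_of_subset_compl Z hZc U hU,
    Scheme.IdealSheafData.vanishingIdeal_bot] at hq
  obtain ⟨e, -, -⟩ := (isBlowup_id_top (U : Scheme.{0})).unique hq
  have hUreg : Scheme.IsRegular (U : Scheme.{0}) := by
    intro u
    exact (Scheme.mem_regularLocus u).mp ((mem_regularLocus_iff_of_flat_of_isPreimmersion U.ι u).mpr (hreg _ u.2))
  exact Scheme.IsRegular.of_iso e.hom hUreg

/-- Over `Spec 𝒪_{X,z}`, `z ∈ Z`, the centre `𝓘_Z` pulls back to `𝔪_z~`, so every blowing up in it is `Bl_{𝔪_z}(Spec 𝒪_{X,z})`.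
[cite: GortzWedhorn2020, Prop. 13.91 (1)–(2)] -/
theorem isRegular_of_isBlowup_comap_fromSpecStalk {X : Scheme.{0}} (Z : Set X) (hZc : IsClosed Z)
    (hpt : ∀ z ∈ Z, IsClosed ({z} : Set X)) (z : X) (hz : z ∈ Z)
    (hloc : Scheme.IsRegular (affineBlowup (maximalIdeal (X.presheaf.stalk z))))
    {P : Scheme.{0}} (q : P ⟶ Spec (X.presheaf.stalk z))
    (hq : IsBlowup q ((Scheme.IdealSheafData.vanishingIdeal ⟨Z, hZc⟩).comap (X.fromSpecStalk z))) :
    Scheme.IsRegular P := by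
  haveI : Flat (X.fromSpecStalk z) := flat_fromSpecStalk X z
  rw [comap_vanishingIdeal_eq_of_flat_of_isPreimmersion, preimage_fromSpecStalk_eq_zeroLocus_maximalIdeal Z hZc hpt z hz,
    FixedStratumAffineCentre.vanishingIdeal_zeroLocus_eq_idealSheaf_of_isRadical _
      (IsLocalRing.maximalIdeal.isMaximal _).isPrime.isRadical] at hq
  obtain ⟨e, -, -⟩ := hq.unique (affineBlowup.isBlowup (maximalIdeal (X.presheaf.stalk z)))
  exact Scheme.IsRegular.of_iso e.inv hloc

/-! ## §3 Blowing up a closed discrete set of points -/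

/-- ★ **Blowing up a closed set of closed points is regular as soon as it is so in the local rings.** `X` locally Noetherian,
`Z ⊆ X` closed with all its points closed, `X ∖ Z` regular, `Bl_{𝔪_z}(Spec 𝒪_{X,z})` regular for `z ∈ Z`: every blowing up of `X`
in the reduced ideal `𝓘_Z` is regular. [cite: GortzWedhorn2020, Prop. 13.91 (2)] [cite: Matsumura1987, Thm. 23.7 (i)] -/
theorem isRegular_of_isBlowup_vanishingIdeal_points {X : Scheme.{0}} [IsLocallyNoetherian X] (Z : Set X) (hZc : IsClosed Z)
    (hpt : ∀ z ∈ Z, IsClosed ({z} : Set X)) (hreg : ∀ x : X, x ∉ Z → x ∈ Scheme.regularLocus X)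
    (hloc : ∀ z ∈ Z, Scheme.IsRegular (affineBlowup (maximalIdeal (X.presheaf.stalk z))))
    {P : Scheme.{0}} (q : P ⟶ X) (hq : IsBlowup q (Scheme.IdealSheafData.vanishingIdeal ⟨Z, hZc⟩)) :
    Scheme.IsRegular P := by
  classical
  haveI : IsProper q := hq.isProper
  haveI : IsLocallyNoetherian P := LocallyOfFiniteType.isLocallyNoetherian q
  set U : X.Opens := ⟨Zᶜ, hZc.isOpen_compl⟩ with hU
  -- the covering family: `X ∖ Z` (index `none`) and `Spec 𝒪_{X,z}`, `z ∈ Z` (index `some z`)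
  let F : Option Z → Over X := fun k => k.elim (Over.mk U.ι) (fun z => Over.mk (X.fromSpecStalk (z : X)))
  haveI hflat : ∀ k, Flat ((F k).hom) := by
    intro k
    cases k with
    | none =>
      change Flat U.ι
      infer_instance
    | some z =>
      change Flat (X.fromSpecStalk (z : X))
      exact flat_fromSpecStalk X (z : X)
  refine hq.isRegular_of_flat_cover (V := fun k => (F k).left) (fun k => (F k).hom) ?_ ?_
  · -- jointly surjective
    intro x
    by_cases hx : x ∈ Z
    · exact ⟨some ⟨x, hx⟩, closedPoint (X.presheaf.stalk x), Scheme.fromSpecStalk_closedPoint⟩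
    · exact ⟨none, (⟨x, hx⟩ : U), rfl⟩
  · intro k P' q' hq'
    cases k with
    | none => exact isRegular_of_isBlowup_comap_opens Z hZc U (fun x hx => hx) (fun x hx => hreg x hx) q' hq'
    | some z => exact isRegular_of_isBlowup_comap_fromSpecStalk Z hZc hpt z z.2 (hloc z z.2) q' hq'

/-! ## §4 The conifold step of the intrinsic recipe, packaged -/

/-- ★★ **THE POINT STEP PACKAGED INTO ONE CHARACTERISTIC IDEAL.** `R` Noetherian, `J₁ ⊇ 𝔪ⁿ` a proper characteristic ideal,
`X₁ = Bl_{J₁}(Spec R)`; `Z ⊆ X₁` a closed set of closed points lying over `V(𝔪)`, mapped into itself by every automorphism of `X₁`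
covering an automorphism of `Spec R`, with `X₁ ∖ Z` regular and `Bl_{𝔪_z}(Spec 𝒪_{X₁,z})` regular for every `z ∈ Z`. Then there is a
CHARACTERISTIC ideal `J₂ ⊇ 𝔪ᶜ`, `J₂ ≠ ⊤`, with `Bl_{J₂}(Spec R)` regular — the input of
`…GaloisCharacteristicCentre.hloc_of_characteristic_ideal_adicCompletion` (p838347). [cite: StacksProject, Tag 080B]
[cite: GortzWedhorn2020, Prop. 13.91] -/
theorem exists_characteristic_ideal_isRegular_of_pointStep {R : Type} [CommRing R] [IsNoetherianRing R] (𝔪 J₁ : Ideal R) {n : ℕ}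
    (hn : 𝔪 ^ n ≤ J₁) (hJ₁top : J₁ ≠ ⊤) (hJ₁ : ∀ θ : R ≃+* R, J₁.map (θ : R →+* R) ≤ J₁)
    (Z : Set (affineBlowup J₁)) (hZc : IsClosed Z) (hpt : ∀ z ∈ Z, IsClosed ({z} : Set (affineBlowup J₁)))
    (hZ𝔪 : ∀ z ∈ Z, 𝔪 ≤ (affineBlowup.π J₁ z).asIdeal)
    (hZstab : ∀ Θ : affineBlowup J₁ ≅ affineBlowup J₁,
      (∃ σ : Spec (.of R) ⟶ Spec (.of R), Θ.hom ≫ affineBlowup.π J₁ = affineBlowup.π J₁ ≫ σ) → Θ.hom '' Z ⊆ Z)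
    (hreg : ∀ x : affineBlowup J₁, x ∉ Z → x ∈ Scheme.regularLocus (affineBlowup J₁))
    (hloc : ∀ z ∈ Z, Scheme.IsRegular (affineBlowup (maximalIdeal ((affineBlowup J₁).presheaf.stalk z)))) :
    ∃ (J₂ : Ideal R) (c : ℕ), (∀ θ : R ≃+* R, J₂.map (θ : R →+* R) ≤ J₂) ∧ 𝔪 ^ c ≤ J₂ ∧ J₂ ≠ ⊤ ∧
      Scheme.IsRegular (affineBlowup J₂) := by
  haveI : IsLocallyNoetherian (affineBlowup J₁) := LocallyOfFiniteType.isLocallyNoetherian (affineBlowup.π J₁)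
  set 𝒦 : (affineBlowup J₁).IdealSheafData := Scheme.IdealSheafData.vanishingIdeal ⟨Z, hZc⟩ with h𝒦
  have h𝒦stab : ∀ Θ : affineBlowup J₁ ≅ affineBlowup J₁,
      (∃ σ : Spec (.of R) ⟶ Spec (.of R), Θ.hom ≫ affineBlowup.π J₁ = affineBlowup.π J₁ ≫ σ) → 𝒦.comap Θ.hom ≤ 𝒦 :=
    fun Θ hΘ => CharacteristicTowerCentre.comap_vanishingIdeal_le_of_image_subset Θ ⟨Z, hZc⟩ (hZstab Θ hΘ)
  have hb : (affineBlowup.idealSheaf (𝔪 ^ 1)).comap (affineBlowup.π J₁) ≤ 𝒦 := by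
    rw [pow_one]
    exact CharacteristicTowerCentre.idealSheaf_comap_le_vanishingIdeal_of_subset _ 𝔪 ⟨Z, hZc⟩ hZ𝔪
  obtain ⟨X₂, p', hp'⟩ := exists_isBlowup (affineBlowup J₁) 𝒦
  have hreg₂ : Scheme.IsRegular X₂ := isRegular_of_isBlowup_vanishingIdeal_points Z hZc hpt hreg hloc p' hp'
  exact CharacteristicTower.exists_characteristic_ideal_isRegular_of_tower 𝔪 J₁ hn hJ₁top hJ₁ 𝒦 h𝒦stab hb p' hp' hreg₂

/-- **The same with `Z = Sing X₁`** (closed, consisting of closed points over `V(𝔪)`, each resolved by blowing up its maximal ideal):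
stability under automorphisms and regularity off `Z` are then automatic. [cite: StacksProject, Tag 080B] [folklore] -/
theorem exists_characteristic_ideal_isRegular_of_singularPoints {R : Type} [CommRing R] [IsNoetherianRing R] (𝔪 J₁ : Ideal R)
    {n : ℕ} (hn : 𝔪 ^ n ≤ J₁) (hJ₁top : J₁ ≠ ⊤) (hJ₁ : ∀ θ : R ≃+* R, J₁.map (θ : R →+* R) ≤ J₁)
    (hZc : IsClosed (Scheme.regularLocus (affineBlowup J₁))ᶜ)
    (hpt : ∀ z ∈ (Scheme.regularLocus (affineBlowup J₁))ᶜ, IsClosed ({z} : Set (affineBlowup J₁)))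
    (hZ𝔪 : ∀ z ∈ (Scheme.regularLocus (affineBlowup J₁))ᶜ, 𝔪 ≤ (affineBlowup.π J₁ z).asIdeal)
    (hloc : ∀ z ∈ (Scheme.regularLocus (affineBlowup J₁))ᶜ,
      Scheme.IsRegular (affineBlowup (maximalIdeal ((affineBlowup J₁).presheaf.stalk z)))) :
    ∃ (J₂ : Ideal R) (c : ℕ), (∀ θ : R ≃+* R, J₂.map (θ : R →+* R) ≤ J₂) ∧ 𝔪 ^ c ≤ J₂ ∧ J₂ ≠ ⊤ ∧
      Scheme.IsRegular (affineBlowup J₂) :=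
  exists_characteristic_ideal_isRegular_of_pointStep 𝔪 J₁ hn hJ₁top hJ₁ _ hZc hpt hZ𝔪
    (fun Θ _ => CharacteristicTowerCentre.image_compl_regularLocus_subset Θ) (fun _ hx => not_not.mp hx) hloc

end Summit.ResolutionOfSingularities.ResolutionOfSingularities.Theorems.FRationalResolution.PointCentreBlowupRegular

end
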